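import Literature.MathematicalPhysics.QuantumLattice.EmeryThreeBandCuO4ClusterDictionary
import Literature.MathematicalPhysics.QuantumLattice.EmeryThreeBandPhysClusterTrialCap
import Literature.MathematicalPhysics.QuantumLattice.HubbardTPPBoxHamiltonian
import HarnessLib

/-!
# THE THREE-BAND CAP FROM ONE CLUSTER VECTOR (Rayleigh form): the fourteen atom Hamiltonians of the open `Cu₄O₈` block (`2×2` cells, 12 physical sites)
# relabelled onto `Fin 1 ×ₗ Fin 12` ARE `hubbardOpenBoxGP 1 12` with explicit `0/1` tables, so a unit `N`-particle cluster vector `φ` gives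
# `emeryEnergyDensity θ (N/16) ≤ (1/16) Σ_a θ_a Re⟨φ, h^G_a φ⟩` at EVERY `θ`

Topic `Literature/MathematicalPhysics/QuantumLattice` (family `hubbard`; crew hubbard-fast S2 (iv) «three-band Emery boxes»). The CAP producer law
`emeryEnergyDensity_le_sum_physClusterTraces` (`EmeryThreeBandPhysClusterTrialCap`) caps the typed three-band density by fourteen traces
`Re tr(D_{a,S} ρ_S)` of ONE density matrix on the physical sites `S = emeryPhysSites m`; the Downfold cap door `EmeryClusterCapSeam` (hubbard-downfold-mod-4)
turns such an affine cap into box words. For the kernel cluster device (hubbard-box-p2: coded application of `hubbardOpenBoxGP a b τ υ ν` to coded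
rational vectors) the operators `D_{a,S}` must be general-pair clusters on `Fin a ×ₗ Fin b`. This file does it for the block `m = (1,1)` (`Cu₄O₈`, the
best cap block of box-p3's EMERY-WINDOWS-g18; filling-`5/4` sector `(10,10)` of dimension `4356`):

* §1 the twelve physical sites in LEXICOGRAPHIC order `cu4o8Site = ((0,0),(0,1),(0,2),(0,3),(1,0),(1,2),(2,0),(2,1),(2,2),(2,3),(3,0),(3,2))`
  = (Cu,O_y,Cu,O_y,O_x,O_x,Cu,O_y,Cu,O_y,O_x,O_x), ranks `0..11`, and **`cu4o8SiteEquiv : PolySite (emeryPhysSites ![1,1]) ≃ Fin 1 ×ₗ Fin 12`**;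
* §2 KERNEL-DECIDED TABLES: the bond class `cu4o8AtomOf` between ranks (12 Cu–O bonds, 9 O–O bonds of the open block), the on-site atoms per rank, and
  the per-atom `0/1` tables **`cu4o8Tau a`, `cu4o8Ups a`, `cu4o8Nu a`** on `Fin 1 ×ₗ Fin 12`;
  **`relabel_block_emeryAtoms : relabel (Orb.mapEquiv cu4o8SiteEquiv) ((emeryAtoms a).localHamiltonian S) = hubbardOpenBoxGP 1 12 (cu4o8Tau a) (cu4o8Ups a) (cu4o8Nu a)`**;
* §3 **`emeryEnergyDensity_le_block2x2_rayleigh`**: for a unit `N`-particle vector `φ` of the cluster Fock space over `Fin 1 ×ₗ Fin 12`,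
  `emeryEnergyDensity θ (N/16) ≤ (1/16)·Σ_a θ_a·Re⟨φ, hubbardOpenBoxGP 1 12 (cu4o8Tau a) (cu4o8Ups a) (cu4o8Nu a) φ⟩` for EVERY `θ`
  (pull back `|φ⟩⟨φ|` along the site bijection, `EmeryThreeBandPhysClusterTrialCap`); La₂CuO₄: `N = 20`.

Everything is PROVED (0 sorry); definitions with bodies: `cu4o8Site`, `cu4o8Rank`, `cu4o8SiteEquiv`, `cu4o8AtomOf`, `cu4o8UAtomOf`, `cu4o8EpsAtomOf`,
`cu4o8Tau`, `cu4o8Ups`, `cu4o8Nu`. HONEST SCOPE: plumbing; the vector and its fourteen quadratic forms are the device's; no number.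

## Tree / Mathlib search

REUSED: `emeryPhysSites`, `emeryEnergyDensity_le_sum_physClusterTraces`, `card_cell_block_eq` (`EmeryThreeBandPhysClusterTrialCap`);
`localHamiltonian_reweight_emeryAtoms`, `emeryAtomGP`, `relabel_generalPairHamiltonian`, `hubbardOpenBoxGP_eq_generalPairHamiltonian`, `hopIndNat`, `hopInd_eq_cast`,
`emeryAtomU/Eps_eq_cast`, `emeryAtomUNat/EpsNat` (`EmeryThreeBandGeneralPairForm`, `EmeryThreeBandCuO4ClusterDictionary`); `parityAut_vecMulVec_self_of_isNParticle`,
`relabel_parityAut`, `relabel_mapEquiv_totalNumber`, `trace_relabel`, `posSemidef_relabel`, `LiebTwo.isNParticle_iff_totalNumber` (`HubbardTPPBoxHamiltonian` &c.);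
Mathlib `Matrix.posSemidef_vecMulVec_self_star`, `Matrix.trace_vecMulVec`.

## References

* D. Ruelle, *Statistical Mechanics: Rigorous Results* (1969), §3.3 (cluster trial states). [cite: Ruelle1969, §3.3]
* E. Pavarini et al., Phys. Rev. Lett. 87 (2001) 047003, eq. (1). [cite: PavariniEtAl2001, eq. (1)]
* R. Valentí, J. Stolze, P. J. Hirschfeld, Phys. Rev. B 43 (1991) 13743, §II. [cite: ValentiStolzeHirschfeld1991, §II]
-/

noncomputable section

open scoped ComplexOrder BigOperators
open Finset

namespace Literature.MathematicalPhysics.QuantumLattice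

open Matrix HubbardWave0 Literature.Probability.LatticeModels ThermodynamicLimit ClusterLowerBound InfVolFermionState

/-! ### §1. The twelve physical sites of the `2×2`-cell block and the site bijection -/

/-- The block parameter of the `2×2`-cell block (`m = (1,1)`, block `[0,4)²`). [cite: PavariniEtAl2001, eq. (1)] -/
abbrev block2x2 : Fin 2 → ℕ := ![1, 1]

/-- **The physical sites of the block by rank** (lexicographic): `(0,0),(0,1),(0,2),(0,3),(1,0),(1,2),(2,0),(2,1),(2,2),(2,3),(3,0),(3,2)`
= (Cu,O_y,Cu,O_y,O_x,O_x,Cu,O_y,Cu,O_y,O_x,O_x). [cite: PavariniEtAl2001, eq. (1)] -/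
def cu4o8Site : Fin 12 → Site 2 :=
  ![![0, 0], ![0, 1], ![0, 2], ![0, 3], ![1, 0], ![1, 2], ![2, 0], ![2, 1], ![2, 2], ![2, 3], ![3, 0], ![3, 2]]

/-- Every ranked site is a physical site of the block. [cite: PavariniEtAl2001, eq. (1)] -/
theorem cu4o8Site_mem (k : Fin 12) : cu4o8Site k ∈ emeryPhysSites block2x2 := by
  fin_cases k <;> decide

/-- **The rank of a site** (only used on the physical sites). [cite: PavariniEtAl2001, eq. (1)] -/
def cu4o8Rank (x : Site 2) : Fin 12 :=
  if x = cu4o8Site 1 then 1 else if x = cu4o8Site 2 then 2 else if x = cu4o8Site 3 then 3 else if x = cu4o8Site 4 then 4 else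
    if x = cu4o8Site 5 then 5 else if x = cu4o8Site 6 then 6 else if x = cu4o8Site 7 then 7 else if x = cu4o8Site 8 then 8 else
    if x = cu4o8Site 9 then 9 else if x = cu4o8Site 10 then 10 else if x = cu4o8Site 11 then 11 else 0

/-- The rank of a ranked site. [cite: PavariniEtAl2001, eq. (1)] -/
theorem cu4o8Rank_cu4o8Site (k : Fin 12) : cu4o8Rank (cu4o8Site k) = k := by
  fin_cases k <;> decide

/-- **The physical sites of the `2×2`-cell block are exactly the twelve ranked sites** (kernel-decided). [cite: PavariniEtAl2001, eq. (1)] -/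
theorem emeryPhysSites_block2x2_eq : emeryPhysSites block2x2 = (Finset.univ : Finset (Fin 12)).image cu4o8Site := by
  decide

/-- Every physical site of the block is a ranked site. [cite: PavariniEtAl2001, eq. (1)] -/
theorem cu4o8Site_cu4o8Rank {x : Site 2} (hx : x ∈ emeryPhysSites block2x2) : cu4o8Site (cu4o8Rank x) = x := by
  rw [emeryPhysSites_block2x2_eq, Finset.mem_image] at hx
  obtain ⟨k, -, rfl⟩ := hx
  rw [cu4o8Rank_cu4o8Site]

/-- **The site bijection `PolySite (emeryPhysSites (1,1)) ≃ Fin 1 ×ₗ Fin 12`** by rank. [cite: PavariniEtAl2001, eq. (1)] -/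
def cu4o8SiteEquiv : PolySite (emeryPhysSites block2x2) ≃ Fin 1 ×ₗ Fin 12 where
  toFun p := toLex (0, cu4o8Rank (ofLex p.1))
  invFun i := PolySite.pt (cu4o8Site (ofLex i).2) (cu4o8Site_mem _)
  left_inv p := by
    apply Subtype.ext
    show toLex (cu4o8Site (cu4o8Rank (ofLex p.1))) = p.1
    rw [cu4o8Site_cu4o8Rank (PolySite.ofLex_mem p), toLex_ofLex]
  right_inv i := by
    show toLex ((0 : Fin 1), cu4o8Rank (cu4o8Site (ofLex i).2)) = i
    rw [cu4o8Rank_cu4o8Site, show (0 : Fin 1) = (ofLex i).1 from Subsingleton.elim _ _, Prod.mk.eta, toLex_ofLex]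

/-- The inverse bijection sends rank `k` to the site `cu4o8Site k`. [cite: PavariniEtAl2001, eq. (1)] -/
theorem cu4o8SiteEquiv_symm_apply (i : Fin 1 ×ₗ Fin 12) : ofLex (cu4o8SiteEquiv.symm i).1 = cu4o8Site (ofLex i).2 := rfl

/-! ### §2. Kernel-decided tables and the per-atom dictionary -/

section Tables

/-- **The bond class joining two ranks of the block** (`8` = none): 12 Cu–O bonds and 9 O–O bonds. [cite: PavariniEtAl2001, eq. (1)] -/
def cu4o8AtomOf : Fin 12 → Fin 12 → Fin 14 :=
  ![![8, 2, 8, 8, 0, 8, 8, 8, 8, 8, 8, 8],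
    ![2, 8, 3, 8, 5, 7, 8, 8, 8, 8, 8, 8],
    ![8, 3, 8, 2, 8, 0, 8, 8, 8, 8, 8, 8],
    ![8, 8, 2, 8, 8, 5, 8, 8, 8, 8, 8, 8],
    ![0, 5, 8, 8, 8, 8, 1, 4, 8, 8, 8, 8],
    ![8, 7, 0, 5, 8, 8, 8, 6, 1, 4, 8, 8],
    ![8, 8, 8, 8, 1, 8, 8, 2, 8, 8, 0, 8],
    ![8, 8, 8, 8, 4, 6, 2, 8, 3, 8, 5, 7],
    ![8, 8, 8, 8, 8, 1, 8, 3, 8, 2, 8, 0],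
    ![8, 8, 8, 8, 8, 4, 8, 8, 2, 8, 8, 5],
    ![8, 8, 8, 8, 8, 8, 0, 5, 8, 8, 8, 8],
    ![8, 8, 8, 8, 8, 8, 8, 7, 0, 5, 8, 8]]

/-- The repulsion atom on each rank (`11` Cu, `12` O_x, `13` O_y). [cite: PavariniEtAl2001, eq. (1)] -/
def cu4o8UAtomOf : Fin 12 → Fin 14 := ![11, 13, 11, 13, 12, 12, 11, 13, 11, 13, 12, 12]

/-- The site-energy atom on each rank (`8` Cu, `9` O_x, `10` O_y). [cite: PavariniEtAl2001, eq. (1)] -/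
def cu4o8EpsAtomOf : Fin 12 → Fin 14 := ![8, 10, 8, 10, 9, 9, 8, 10, 8, 10, 9, 9]

/-- **THE BOND TABLE OF THE BLOCK** (kernel-decided). [cite: PavariniEtAl2001, eq. (1)] -/
theorem hopIndNat_block (a : Fin 14) (k l : Fin 12) :
    (if a.1 < 8 then hopIndNat liebPeriods (emeryAtomCoset a) (emeryAtomVec a) (cu4o8Site k) (cu4o8Site l) else 0) =
      if a = cu4o8AtomOf k l ∧ (cu4o8AtomOf k l).1 < 8 then 1 else 0 := by
  revert k l
  fin_cases a <;> decide

/-- **THE REPULSION TABLE OF THE BLOCK** (kernel-decided). [cite: PavariniEtAl2001, eq. (1)] -/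
theorem emeryAtomUNat_mul_coset_block (a : Fin 14) (k : Fin 12) :
    emeryAtomUNat a * (if InCoset liebPeriods (emeryAtomCoset a) (cu4o8Site k) then 1 else 0) = if a = cu4o8UAtomOf k then 1 else 0 := by
  revert a k
  decide

/-- **THE SITE-ENERGY TABLE OF THE BLOCK** (kernel-decided). [cite: PavariniEtAl2001, eq. (1)] -/
theorem emeryAtomEpsNat_mul_coset_block (a : Fin 14) (k : Fin 12) :
    emeryAtomEpsNat a * (if InCoset liebPeriods (emeryAtomCoset a) (cu4o8Site k) then 1 else 0) = if a = cu4o8EpsAtomOf k then 1 else 0 := by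
  revert a k
  decide

/-- **The per-atom pair table** on `Fin 1 ×ₗ Fin 12`: `1` on the bonds of class `a`, else `0`. [cite: PavariniEtAl2001, eq. (1)] -/
def cu4o8Tau (a : Fin 14) (i j : Fin 1 ×ₗ Fin 12) : ℝ :=
  if a = cu4o8AtomOf (ofLex i).2 (ofLex j).2 ∧ (cu4o8AtomOf (ofLex i).2 (ofLex j).2).1 < 8 then 1 else 0

/-- **The per-atom repulsion table**: `1` on the ranks carrying the repulsion atom `a`. [cite: PavariniEtAl2001, eq. (1)] -/
def cu4o8Ups (a : Fin 14) (i : Fin 1 ×ₗ Fin 12) : ℝ := if a = cu4o8UAtomOf (ofLex i).2 then 1 else 0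

/-- **The per-atom site-energy table**: `1` on the ranks carrying the site-energy atom `a`. [cite: PavariniEtAl2001, eq. (1)] -/
def cu4o8Nu (a : Fin 14) (i : Fin 1 ×ₗ Fin 12) : ℝ := if a = cu4o8EpsAtomOf (ofLex i).2 then 1 else 0

/-- Every element of `Fin 1 ×ₗ Fin 12` is `(0, k)`. [folklore] -/
private theorem lex_eq_toLex₁₂ (i : Fin 1 ×ₗ Fin 12) : i = toLex ((0 : Fin 1), (ofLex i).2) := by
  rw [show (0 : Fin 1) = (ofLex i).1 from Subsingleton.elim _ _, Prod.mk.eta, toLex_ofLex]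

/-- The pair coefficient (unit weight) at concrete sites, as a cast of naturals. [cite: ValentiStolzeHirschfeld1991, §II] -/
private theorem emeryAtomPairCoef_one_pt {Λ : Finset (Site 2)} (a : Fin 14) (x y : Site 2) (hx : x ∈ Λ) (hy : y ∈ Λ) :
    emeryAtomPairCoef (fun _ => 1) Λ a (PolySite.pt x hx) (PolySite.pt y hy) =
      ((if a.1 < 8 then hopIndNat liebPeriods (emeryAtomCoset a) (emeryAtomVec a) x y else 0 : ℕ) : ℝ) := by
  unfold emeryAtomPairCoef
  rw [PolySite.ofLex_coe_pt, PolySite.ofLex_coe_pt, hopInd_eq_cast, one_mul]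
  push_cast
  rfl

/-- The repulsion coefficient (unit weight) at a concrete site, as a cast of naturals. [cite: ValentiStolzeHirschfeld1991, §II] -/
private theorem emeryAtomUCoef_one_pt {Λ : Finset (Site 2)} (a : Fin 14) (x : Site 2) (hx : x ∈ Λ) :
    emeryAtomUCoef (fun _ => 1) Λ a (PolySite.pt x hx) = ((emeryAtomUNat a * (if InCoset liebPeriods (emeryAtomCoset a) x then 1 else 0) : ℕ) : ℝ) := by
  unfold emeryAtomUCoef
  rw [PolySite.ofLex_coe_pt, emeryAtomU_eq_cast, one_mul]
  push_cast
  rfl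

/-- The site-energy coefficient (unit weight) at a concrete site, as a cast of naturals. [cite: ValentiStolzeHirschfeld1991, §II] -/
private theorem emeryAtomECoef_one_pt {Λ : Finset (Site 2)} (a : Fin 14) (x : Site 2) (hx : x ∈ Λ) :
    emeryAtomECoef (fun _ => 1) Λ a (PolySite.pt x hx) = ((emeryAtomEpsNat a * (if InCoset liebPeriods (emeryAtomCoset a) x then 1 else 0) : ℕ) : ℝ) := by
  unfold emeryAtomECoef
  rw [PolySite.ofLex_coe_pt, emeryAtomEps_eq_cast, one_mul]
  push_cast
  rfl

/-- An interaction reweighted by the constant weight `1` is itself. [folklore] -/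
private theorem reweight_one_eq (Ψ : FermionInteraction 2) : (⟨fun X => (((fun _ => (1 : ℝ)) X : ℝ) : ℂ) • Ψ.Φ X⟩ : FermionInteraction 2) = Ψ := by
  cases Ψ
  show FermionInteraction.mk _ = FermionInteraction.mk _
  congr 1
  funext X
  rw [Complex.ofReal_one, one_smul]

/-- **THE PER-ATOM BLOCK DICTIONARY**: relabelled by rank, the atom Hamiltonian `D_{a,S}` on the physical sites of the block IS
`hubbardOpenBoxGP 1 12 (cu4o8Tau a) (cu4o8Ups a) (cu4o8Nu a)`. [cite: PavariniEtAl2001, eq. (1)] [cite: ValentiStolzeHirschfeld1991, §II] -/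
theorem relabel_block_emeryAtoms (a : Fin 14) :
    relabel (Orb.mapEquiv cu4o8SiteEquiv) ((emeryAtoms a).localHamiltonian (emeryPhysSites block2x2)) =
      hubbardOpenBoxGP 1 12 (cu4o8Tau a) (cu4o8Ups a) (cu4o8Nu a) := by
  have h := localHamiltonian_reweight_emeryAtoms (fun _ => (1 : ℝ)) (emeryPhysSites block2x2) a
  rw [reweight_one_eq] at h
  rw [h, emeryAtomGP, relabel_generalPairHamiltonian, hubbardOpenBoxGP_eq_generalPairHamiltonian]
  have hτ : (fun i j => emeryAtomPairCoef (fun _ => (1 : ℝ)) (emeryPhysSites block2x2) a (cu4o8SiteEquiv.symm i) (cu4o8SiteEquiv.symm j)) = cu4o8Tau a := by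
    funext i j
    rw [lex_eq_toLex₁₂ i, lex_eq_toLex₁₂ j]
    show emeryAtomPairCoef (fun _ => (1 : ℝ)) _ a (PolySite.pt (cu4o8Site (ofLex i).2) (cu4o8Site_mem _)) (PolySite.pt (cu4o8Site (ofLex j).2) (cu4o8Site_mem _)) = _
    rw [emeryAtomPairCoef_one_pt, hopIndNat_block, cu4o8Tau]
    simp only [ofLex_toLex]
    push_cast
    rfl
  have hυ : (fun i => emeryAtomUCoef (fun _ => (1 : ℝ)) (emeryPhysSites block2x2) a (cu4o8SiteEquiv.symm i)) = cu4o8Ups a := by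
    funext i
    rw [lex_eq_toLex₁₂ i]
    show emeryAtomUCoef (fun _ => (1 : ℝ)) _ a (PolySite.pt (cu4o8Site (ofLex i).2) (cu4o8Site_mem _)) = _
    rw [emeryAtomUCoef_one_pt, emeryAtomUNat_mul_coset_block, cu4o8Ups]
    simp only [ofLex_toLex]
    push_cast
    rfl
  have hν : (fun i => emeryAtomECoef (fun _ => (1 : ℝ)) (emeryPhysSites block2x2) a (cu4o8SiteEquiv.symm i)) = cu4o8Nu a := by
    funext i
    rw [lex_eq_toLex₁₂ i]
    show emeryAtomECoef (fun _ => (1 : ℝ)) _ a (PolySite.pt (cu4o8Site (ofLex i).2) (cu4o8Site_mem _)) = _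
    rw [emeryAtomECoef_one_pt, emeryAtomEpsNat_mul_coset_block, cu4o8Nu]
    simp only [ofLex_toLex]
    push_cast
    rfl
  rw [hτ, hυ, hν]

end Tables

/-! ### §3. The cap from one cluster vector -/

section Rayleigh

/-- `tr(M · |x⟩⟨x|) = ⟨x, M x⟩`. [cite: NielsenChuang2010, §2.4.3 Box 2.6 eqs. (2.181)–(2.182)] -/
private theorem trace_mul_vecMulVec_star' {κ : Type*} [Fintype κ] (M : Matrix κ κ ℂ) (x : κ → ℂ) :
    (M * vecMulVec x (star x)).trace = star x ⬝ᵥ (M *ᵥ x) := by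
  simp only [dotProduct, mulVec, Matrix.trace, Matrix.diag, Matrix.mul_apply, vecMulVec_apply, Pi.star_apply, Finset.mul_sum]
  refine Finset.sum_congr rfl fun i _ => Finset.sum_congr rfl fun j _ => ?_
  ring

/-- The block has sixteen lattice sites (`4·|Cell (1,1)|`). [cite: ArakiMoriya2003, §4.1 Def. 4.3] -/
theorem card_cell_block2x2 : (Fintype.card (Cell (alignedPeriods liebPeriods block2x2)) : ℝ) = 16 := by
  rw [card_cell_block_eq]
  have h : Fintype.card (Cell block2x2) = 4 := by decide
  rw [h]
  norm_num

/-- **THE THREE-BAND CAP FROM ONE CLUSTER VECTOR.** For every unit `N`-particle vector `φ` of the cluster Fock space over `Fin 1 ×ₗ Fin 12` (the twelve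
physical sites of the open `Cu₄O₈` block by rank) and every coupling vector `θ`:
`emeryEnergyDensity θ (N/16) ≤ (1/16)·Σ_a θ_a·Re⟨φ, hubbardOpenBoxGP 1 12 (cu4o8Tau a) (cu4o8Ups a) (cu4o8Nu a) φ⟩`.
(La₂CuO₄ and every undoped cuprate row: `N = 20`, `ρ = 5/4`.) [cite: Ruelle1969, §3.3] [cite: PavariniEtAl2001, eq. (1)] -/
theorem emeryEnergyDensity_le_block2x2_rayleigh (θ : Fin 14 → ℝ) {N : ℕ} {φ : Fock (Orb (Fin 1 ×ₗ Fin 12))} (hφN : IsNParticle N φ)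
    (hφ1 : star φ ⬝ᵥ φ = 1) :
    emeryEnergyDensity θ ((N : ℝ) / 16) ≤
      (1 / 16) * ∑ a : Fin 14, θ a * (star φ ⬝ᵥ (hubbardOpenBoxGP 1 12 (cu4o8Tau a) (cu4o8Ups a) (cu4o8Nu a) *ᵥ φ)).re := by
  set P : Matrix (Finset (Orb (Fin 1 ×ₗ Fin 12))) (Finset (Orb (Fin 1 ×ₗ Fin 12))) ℂ := vecMulVec φ (star φ) with hP
  have hPev : parityAut P = P := parityAut_vecMulVec_self_of_isNParticle hφN
  have hPtr : P.trace = 1 := by rw [hP, trace_vecMulVec, dotProduct_comm, hφ1]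
  set ρS : FermionOp (emeryPhysSites block2x2) := relabel (Orb.mapEquiv cu4o8SiteEquiv).symm P with hρS
  have hev : parityAut ρS = ρS := by rw [hρS, ← relabel_parityAut, hPev]
  have hpsd : ρS.PosSemidef := posSemidef_relabel _ (Matrix.posSemidef_vecMulVec_self_star φ)
  have htr : ρS.trace = 1 := by rw [hρS, trace_relabel, hPtr]
  -- the particle number of the pulled-back projector
  have hN : ((totalNumber : FermionOp (emeryPhysSites block2x2)) * ρS).trace.re = 4 * Fintype.card (Cell block2x2) * ((N : ℝ) / 16) := by
    have hc : Fintype.card (Cell block2x2) = 4 := by decide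
    have h1 : (totalNumber : FermionOp (emeryPhysSites block2x2)) = relabel (Orb.mapEquiv cu4o8SiteEquiv).symm totalNumber := by
      rw [show (Orb.mapEquiv cu4o8SiteEquiv).symm = Orb.mapEquiv cu4o8SiteEquiv.symm from rfl, relabel_mapEquiv_totalNumber]
    rw [h1, hρS, show (Orb.mapEquiv cu4o8SiteEquiv).symm = Orb.mapEquiv cu4o8SiteEquiv.symm from rfl, ← map_mul, trace_relabel, hP,
      trace_mul_vecMulVec_star', (LiebTwo.isNParticle_iff_totalNumber N φ).1 hφN, dotProduct_smul, hφ1, smul_eq_mul, mul_one, hc,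
      Complex.natCast_re]
    ring
  have h := emeryEnergyDensity_le_sum_physClusterTraces block2x2 ρS hev hpsd htr hN θ
  rw [card_cell_block2x2] at h
  -- the fourteen traces are the cluster vector's quadratic forms
  have htr_a : ∀ a : Fin 14, (((emeryAtoms a).localHamiltonian (emeryPhysSites block2x2)) * ρS).trace =
      star φ ⬝ᵥ (hubbardOpenBoxGP 1 12 (cu4o8Tau a) (cu4o8Ups a) (cu4o8Nu a) *ᵥ φ) := by
    intro a
    have hrel : (emeryAtoms a).localHamiltonian (emeryPhysSites block2x2) =
        relabel (Orb.mapEquiv cu4o8SiteEquiv).symm (hubbardOpenBoxGP 1 12 (cu4o8Tau a) (cu4o8Ups a) (cu4o8Nu a)) := by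
      rw [← relabel_block_emeryAtoms, relabel_symm_relabel]
    rw [hrel, hρS, ← map_mul, trace_relabel, hP, trace_mul_vecMulVec_star']
  simp only [htr_a] at h
  rw [one_div]
  exact h

end Rayleigh

end Literature.MathematicalPhysics.QuantumLattice

end
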